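import Summits.SmoothPoincare4.SmoothPoincare4.Theses.EntropyRung
import Summits.SmoothPoincare4.SmoothPoincare4.Theorems.ConicalGap.Negative.LoadBearingHypotheses
import Summits.SmoothPoincare4.SmoothPoincare4.Theorems.NoncompactShrinkerGap.Negative.TightAtCylinder
import Literature.Geometry.Riemannian.GaussianShrinker
import Literature.Geometry.Riemannian.ShrinkingRoundSphereFour
import Literature.Geometry.Riemannian.RoundCylinderFourVolume
import Literature.Geometry.Riemannian.PuncturedShrinkingSphereFour
import Literature.Geometry.Riemannian.ShrinkerScalarCurvatureNonnegHolds

/-!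
# Disproof of `ConicalGap` (item stmt-SmoothPoincare4-16589, route EntropyRung, rank 8) — findings

Standing adversary file (refuter-cdisprove, gen 1, cycle 1, 2026-08-16). The crux is RESIDUE 1 of the parent crux
`NoncompactShrinkerGap` (stmt-SmoothPoincare4-10868, adversary file `Cruxes/NoncompactShrinkerGap/Disproof.lean`,
whose §§2, 3, 6, 8, 10 apply verbatim and are not repeated): the density gap

> complete connected non-compact non-flat normalised 4-d gradient shrinker (`Ric + Hess f = g/2`,
> `R + |∇f|² = f`, `R ≢ 0`) whose scalar curvature DECAYS at infinity (`∀ ε > 0 ∃ K` compact, `R < ε` off `K`)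
> has `∫ e^{-f} dV ≤ 32π²√π e^{-3/2} = (4π)²·Θ(S³×ℝ) ≈ 124.9` (`Θ ≤ .791`),

i.e. the parent restricted to the ASYMPTOTICALLY CONICAL class (Munteanu–Wang: `R → 0` ⇒ every end is smoothly
asymptotic to a cone `C(N³)`; Kotschwar–Wang: the cone determines the shrinker). VERDICT OF THIS CYCLE: no kill; the
statement is a genuine open problem as filed (grounder, rattack refuter, this seat agree); FIK (`Θ = e^{√2−2}(1+√2)/2
= .672`) is the ONLY complete member of the class in print. Index of what is CHECKED here (sorry-free unless in §(e)):

1. **Formal audit — no junk kill; one-sided decay clause is immaterial for the crux (PROVED).** The parent's audit of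
   the vocabulary (genuine Koszul connection / curvature / `riemannianEDist` / `μH`-volume) stands. The new clause is
   `∀ ε>0, ∀ᶠ x in cocompact M, R x < ε` (Negative/DecayClause.lean, p126814): ONE-SIDED, but by Zhang 2009 Thm 1.3(ii),
   PROVED in the tree (`shrinkerScalarCurvature_nonneg_holds`), complete shrinkers have `R ≥ 0`, so
   `conicalGap_iff_twoSided` and `conicalGap_iff_nonnegScalar` (§(c')) hold UNCONDITIONALLY: the crux equals its
   two-sided (`|R| → 0`) and its `R ≥ 0` variants. Redundant binder `[T3Space M]` (`t3Space_of_chartedSpace`); hidden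
   finiteness `∫ e^{-f} < ∞` (`lintegral_lt_top_of_conicalGap`).
2. **Load-bearing hypotheses (§(a),(b),(e)).** non-flatness — FALSE without it (Gaussian; LANDED p124122, re-exported
   here); non-compactness — FALSE without it (`S⁴(√6)`, decay vacuous via `K = univ`; LANDED p124122); COMPLETENESS —
   FALSE without it by an EXPLICIT CLOSED-FORM FAMILY found this cycle (§(e) `conicalGap_false_without_complete`,
   sorried only for want of a U(2)-Kähler model in the tree): the Calabi-ansatz Kähler shrinkers on `{|z| > r₀} ⊂ ℂ²`
   with momentum profile `ψ_μ(φ) = φ/μ + 2(1−μ)/μ² + 2(1−μ)/(μ³φ)`, `0 < μ < 1` (`λ = 1` units; FIK is `μ = √2`,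
   the Gaussian `μ = 1`), have `R = 2(μ−1)/(μφ) < 0` (so the decay clause holds with `K = ∅`!), satisfy every other
   hypothesis, are incomplete at the inner end, and have `∫ e^{-f} dV = 16π²·e^{2(μ−1)}/μ² > 16π² > 124.9` —
   density ABOVE the Gaussian and unbounded as `μ → 0`; numerically also SO(4)-invariant conical annuli with `R > 0`,
   `R → 0` at both ends and mass `156 > 124.9` (§(f)): completeness is load-bearing even against two-sided decay and
   `R > 0`, i.e. NO END-ONLY ARGUMENT CAN PROVE THE CRUX — the whole gap `1 → .791` is made in the compact core;
   connectedness — false without it (`S⁴(√6) ⊔ ℝ⁴_Gauss`: both components in the tree, `Sum`-manifold plumbing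
   missing; §(e)); normalisation — false without it (FIK with `f − c`, `c > .164`; FIK not in the tree; §(e));
   DECAY — dropping it gives back the parent crux (`conicalGapWithoutDecay_iff`, `Iff.rfl`), so decay is load-bearing
   for TRUTH only if the parent is false: it is a proof-enabling restriction, and its one certified effect is to
   EXCLUDE the parent's extremiser `S³(2)×ℝ` and the parent's completeness / normalisation witnesses (§(c)).
3. **Tightness is LOST in this class (§(c)).** `excludedExtremiser`: the model attaining `32π²√πe^{-3/2}` exactly
   (`noncompactShrinkerGap_tight_at_cylinder`) violates decay (`R ≡ 3/2`); nothing in the tree or in print attains or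
   approaches the bound inside the class (FIK `.672`, margin 15 %; `fikDensity_lt_thetaCyl` checks the arithmetic
   `e^{√2−2}(1+√2)/2 < 2√πe^{-3/2}`). So the STRICT form and even "`Θ ≤ Θ(S²×ℝ²) = 2/e`" or "`Θ ≤ Θ(FIK)`" on the
   conical class are NOT refuted — provers may have slack; refuters have no sharpness witness.
4. **Line `Sketch` (card avr-window, lead gen 1, skeleton v1; §(d)).** Stubs 1–4 (weighted integrability; Wang–Wang
   (2.9)–(2.10) `∫(f−2τ)e^{-f/τ} = (1−τ)∫Re^{-f/τ}`; finite transform; monotone limit) SURVIVE: checked by hand on the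
   Gaussian (`32π²τ³ − 2τ·16π²τ² = 0`), `S⁴(√6)` (`(2−2τ)e^{-2/τ}V` both sides) and `S³(2)×ℝ` (factor `3/2(1−τ)` both
   sides), and numerically on FIK by ideator 1 (`Θ − AVR = .172`); joint sufficiency holds (`ConicalGap_of` is
   sorry-free over the stubs). The apex `stub_coreBudget` is the crux in transformed coordinates and inherits finding 2
   verbatim: on the explicit incomplete family `a = 1/μ² > 1` (a FAT cone, `AVR > 1`) and `∫⁻ ofReal(R·k(f)) = 0`
   (`R < 0` is clipped by `ofReal`), so `stub_coreBudget` minus completeness is false by the same witnesses; and the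
   clipping means the apex is equivalent to the crux only through `R ≥ 0` (available: Zhang, proved). No stub is
   refuted. Targets handed over: none (payload.targets = []).
5. **Where a counterexample must live** (refined for the conical class; for ideators). A complete non-compact
   non-flat 4-d gradient shrinker with `R → 0` and `Θ ∈ (.791, 1)`: NOT Kähler (Li–Wang 2023 classification + DH
   densities ≤ .736, parent §10); NOT cohomogeneity one (parent §8 scan; Kotschwar 2008 for SO(4)); smoothly asymptotic
   to a cone `C(N)` with `AVR = Vol(N)/2π² ≤ Θ < 1 − δ₀` (Wang–Wang 2023 Thm 1.1; Yokota) and, by the transform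
   identity of line `Sketch`, `Θ = AVR + (16π²)⁻¹∫R k(f) dV`; each conical end is non-parabolic (Munteanu–Sesum 2013
   Prop 3.3, threshold `R < n/2 − 1 = 1`), the number of ends of a non-Kähler AC shrinker is not bounded in print
   (searched: zbMATH; local FTS / OpenAlex / S2 degraded this session). By finding 2 the excess over `.791` must be
   produced by the CORE (smooth closing at a NUT/bolt), not by the end: the explicit conical ENDS of every cone angle
   already carry density up to and beyond `1`. No such object is known; cohomogeneity-two (`U(1)×U(1)`, non-Kähler)
   is the first unscanned symmetric class and is a 2-d elliptic free-boundary problem (BCCD-type numerics), not a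
   session computation.

Provers: cite `Negative.conicalGap_false_without_nonflat/_noncompact` (p124122), `Negative/DecayClause.lean`
(p126814: filter form, one-sidedness, excluded parent witnesses), `Negative/TightnessLost.lean` (p127053:
`conicalGap_excludedExtremiser`, `conicalGap_fikDensity_lt_thetaCyl`), `conicalGap_iff_twoSided`,
`conicalGap_iff_nonnegScalar`, `excludedExtremiser`, `fikDensity_lt_thetaCyl`, and the explicit incomplete
family of §(e) (evidence `compute/calabi_family.py`, `compute/conical_ends.py`, `CompletenessWitness.md` on the item).
-/

noncomputable section

set_option linter.dupNamespace false

open Bundle Set Function Filter Manifold Metric Module MeasureTheory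
open scoped Manifold ContDiff Topology RealInnerProductSpace ENNReal NNReal
open Literature.Geometry.Lorentzian Literature.Geometry.Lorentzian.PseudoRiemannianMetric
open Literature.Geometry.Riemannian

namespace Summit.SmoothPoincare4.SmoothPoincare4.Cruxes.ConicalGap.Disproof

open Summit.SmoothPoincare4.SmoothPoincare4.Theses.EntropyRung
open Summit.SmoothPoincare4.SmoothPoincare4.Theorems

/-! ## (a) Load-bearing analysis: the crux with one hypothesis dropped / altered -/

/-- `ConicalGap` with NON-FLATNESS `∃ x, R x ≠ 0` dropped. FALSE (Gaussian `ℝ⁴`, decay with `K = ∅`):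
`conicalGap_false_without_nonflat'`. [folklore] -/
def ConicalGapWithoutNonflat : Prop :=
  ∀ (M : Type) [TopologicalSpace M] [T2Space M] [SecondCountableTopology M]
    [ChartedSpace (EuclideanSpace ℝ (Fin 4)) M] [IsManifold (𝓡 4) ∞ M] [ConnectedSpace M]
    [NoncompactSpace M] [T3Space M] [MeasurableSpace M] [BorelSpace M]
    (g : PseudoRiemannianMetric (𝓡 4) ∞ (EuclideanSpace ℝ (Fin 4)) (TangentSpace (𝓡 4) : M → Type _))
    [g.HasLeviCivita] (f : M → ℝ) (hg : g.IsRiemannian),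
    (∀ (x : M) (r : NNReal), IsCompact {y : M | g.edist hg x y ≤ r}) →
    ContMDiff (𝓡 4) 𝓘(ℝ, ℝ) ∞ f →
    (∀ (x : M) (X Y : TangentSpace (𝓡 4) x),
      g.ricci x X Y + g.hessian f x X Y = (1 / 2 : ℝ) * g.val x X Y) →
    (∀ x : M, g.scalarCurvature x + g.gradSq f x = f x) →
    (∀ ε : ℝ, 0 < ε → ∃ K : Set M, IsCompact K ∧ ∀ x, x ∉ K → g.scalarCurvature x < ε) →
    ∫⁻ x, ENNReal.ofReal (Real.exp (-f x))
        ∂(riemannianMeasure (g.toContMDiffRiemannianMetric hg)) ≤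
      ENNReal.ofReal (32 * Real.pi ^ 2 * Real.sqrt Real.pi * Real.exp (-(3 : ℝ) / 2))

/-- `ConicalGap` with NON-COMPACTNESS dropped. FALSE (`S⁴(√6)`, `f ≡ 2`, decay with `K = univ`):
`conicalGap_false_without_noncompact'`. [folklore] -/
def ConicalGapWithoutNoncompact : Prop :=
  ∀ (M : Type) [TopologicalSpace M] [T2Space M] [SecondCountableTopology M]
    [ChartedSpace (EuclideanSpace ℝ (Fin 4)) M] [IsManifold (𝓡 4) ∞ M] [ConnectedSpace M]
    [T3Space M] [MeasurableSpace M] [BorelSpace M]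
    (g : PseudoRiemannianMetric (𝓡 4) ∞ (EuclideanSpace ℝ (Fin 4)) (TangentSpace (𝓡 4) : M → Type _))
    [g.HasLeviCivita] (f : M → ℝ) (hg : g.IsRiemannian),
    (∀ (x : M) (r : NNReal), IsCompact {y : M | g.edist hg x y ≤ r}) →
    ContMDiff (𝓡 4) 𝓘(ℝ, ℝ) ∞ f →
    (∀ (x : M) (X Y : TangentSpace (𝓡 4) x),
      g.ricci x X Y + g.hessian f x X Y = (1 / 2 : ℝ) * g.val x X Y) →
    (∀ x : M, g.scalarCurvature x + g.gradSq f x = f x) →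
    (∃ x : M, g.scalarCurvature x ≠ 0) →
    (∀ ε : ℝ, 0 < ε → ∃ K : Set M, IsCompact K ∧ ∀ x, x ∉ K → g.scalarCurvature x < ε) →
    ∫⁻ x, ENNReal.ofReal (Real.exp (-f x))
        ∂(riemannianMeasure (g.toContMDiffRiemannianMetric hg)) ≤
      ENNReal.ofReal (32 * Real.pi ^ 2 * Real.sqrt Real.pi * Real.exp (-(3 : ℝ) / 2))

/-- `ConicalGap` with COMPLETENESS (closed `g.edist`-balls compact) dropped. FALSE by an explicit closed-form
family (§(e) `conicalGap_false_without_complete`, sorried for want of the model in the tree). [folklore] -/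
def ConicalGapWithoutComplete : Prop :=
  ∀ (M : Type) [TopologicalSpace M] [T2Space M] [SecondCountableTopology M]
    [ChartedSpace (EuclideanSpace ℝ (Fin 4)) M] [IsManifold (𝓡 4) ∞ M] [ConnectedSpace M]
    [NoncompactSpace M] [T3Space M] [MeasurableSpace M] [BorelSpace M]
    (g : PseudoRiemannianMetric (𝓡 4) ∞ (EuclideanSpace ℝ (Fin 4)) (TangentSpace (𝓡 4) : M → Type _))
    [g.HasLeviCivita] (f : M → ℝ) (hg : g.IsRiemannian),
    ContMDiff (𝓡 4) 𝓘(ℝ, ℝ) ∞ f →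
    (∀ (x : M) (X Y : TangentSpace (𝓡 4) x),
      g.ricci x X Y + g.hessian f x X Y = (1 / 2 : ℝ) * g.val x X Y) →
    (∀ x : M, g.scalarCurvature x + g.gradSq f x = f x) →
    (∃ x : M, g.scalarCurvature x ≠ 0) →
    (∀ ε : ℝ, 0 < ε → ∃ K : Set M, IsCompact K ∧ ∀ x, x ∉ K → g.scalarCurvature x < ε) →
    ∫⁻ x, ENNReal.ofReal (Real.exp (-f x))
        ∂(riemannianMeasure (g.toContMDiffRiemannianMetric hg)) ≤
      ENNReal.ofReal (32 * Real.pi ^ 2 * Real.sqrt Real.pi * Real.exp (-(3 : ℝ) / 2))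

/-- `ConicalGap` with CONNECTEDNESS dropped. False on paper (`S⁴(√6) ⊔ ℝ⁴_Gauss`, §(e)). [folklore] -/
def ConicalGapWithoutConnected : Prop :=
  ∀ (M : Type) [TopologicalSpace M] [T2Space M] [SecondCountableTopology M]
    [ChartedSpace (EuclideanSpace ℝ (Fin 4)) M] [IsManifold (𝓡 4) ∞ M]
    [NoncompactSpace M] [T3Space M] [MeasurableSpace M] [BorelSpace M]
    (g : PseudoRiemannianMetric (𝓡 4) ∞ (EuclideanSpace ℝ (Fin 4)) (TangentSpace (𝓡 4) : M → Type _))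
    [g.HasLeviCivita] (f : M → ℝ) (hg : g.IsRiemannian),
    (∀ (x : M) (r : NNReal), IsCompact {y : M | g.edist hg x y ≤ r}) →
    ContMDiff (𝓡 4) 𝓘(ℝ, ℝ) ∞ f →
    (∀ (x : M) (X Y : TangentSpace (𝓡 4) x),
      g.ricci x X Y + g.hessian f x X Y = (1 / 2 : ℝ) * g.val x X Y) →
    (∀ x : M, g.scalarCurvature x + g.gradSq f x = f x) →
    (∃ x : M, g.scalarCurvature x ≠ 0) →
    (∀ ε : ℝ, 0 < ε → ∃ K : Set M, IsCompact K ∧ ∀ x, x ∉ K → g.scalarCurvature x < ε) →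
    ∫⁻ x, ENNReal.ofReal (Real.exp (-f x))
        ∂(riemannianMeasure (g.toContMDiffRiemannianMetric hg)) ≤
      ENNReal.ofReal (32 * Real.pi ^ 2 * Real.sqrt Real.pi * Real.exp (-(3 : ℝ) / 2))

/-- `ConicalGap` with the NORMALISATION `R + |∇f|² = f` dropped. False on paper (FIK with `f − c`, §(e)). [folklore] -/
def ConicalGapWithoutNormalisation : Prop :=
  ∀ (M : Type) [TopologicalSpace M] [T2Space M] [SecondCountableTopology M]
    [ChartedSpace (EuclideanSpace ℝ (Fin 4)) M] [IsManifold (𝓡 4) ∞ M] [ConnectedSpace M]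
    [NoncompactSpace M] [T3Space M] [MeasurableSpace M] [BorelSpace M]
    (g : PseudoRiemannianMetric (𝓡 4) ∞ (EuclideanSpace ℝ (Fin 4)) (TangentSpace (𝓡 4) : M → Type _))
    [g.HasLeviCivita] (f : M → ℝ) (hg : g.IsRiemannian),
    (∀ (x : M) (r : NNReal), IsCompact {y : M | g.edist hg x y ≤ r}) →
    ContMDiff (𝓡 4) 𝓘(ℝ, ℝ) ∞ f →
    (∀ (x : M) (X Y : TangentSpace (𝓡 4) x),
      g.ricci x X Y + g.hessian f x X Y = (1 / 2 : ℝ) * g.val x X Y) →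
    (∃ x : M, g.scalarCurvature x ≠ 0) →
    (∀ ε : ℝ, 0 < ε → ∃ K : Set M, IsCompact K ∧ ∀ x, x ∉ K → g.scalarCurvature x < ε) →
    ∫⁻ x, ENNReal.ofReal (Real.exp (-f x))
        ∂(riemannianMeasure (g.toContMDiffRiemannianMetric hg)) ≤
      ENNReal.ofReal (32 * Real.pi ^ 2 * Real.sqrt Real.pi * Real.exp (-(3 : ℝ) / 2))

/-- `ConicalGap` with the DECAY clause dropped — literally the parent crux (`conicalGapWithoutDecay_iff`). [folklore] -/
def ConicalGapWithoutDecay : Prop :=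
  ∀ (M : Type) [TopologicalSpace M] [T2Space M] [SecondCountableTopology M]
    [ChartedSpace (EuclideanSpace ℝ (Fin 4)) M] [IsManifold (𝓡 4) ∞ M] [ConnectedSpace M]
    [NoncompactSpace M] [T3Space M] [MeasurableSpace M] [BorelSpace M]
    (g : PseudoRiemannianMetric (𝓡 4) ∞ (EuclideanSpace ℝ (Fin 4)) (TangentSpace (𝓡 4) : M → Type _))
    [g.HasLeviCivita] (f : M → ℝ) (hg : g.IsRiemannian),
    (∀ (x : M) (r : NNReal), IsCompact {y : M | g.edist hg x y ≤ r}) →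
    ContMDiff (𝓡 4) 𝓘(ℝ, ℝ) ∞ f →
    (∀ (x : M) (X Y : TangentSpace (𝓡 4) x),
      g.ricci x X Y + g.hessian f x X Y = (1 / 2 : ℝ) * g.val x X Y) →
    (∀ x : M, g.scalarCurvature x + g.gradSq f x = f x) →
    (∃ x : M, g.scalarCurvature x ≠ 0) →
    ∫⁻ x, ENNReal.ofReal (Real.exp (-f x))
        ∂(riemannianMeasure (g.toContMDiffRiemannianMetric hg)) ≤
      ENNReal.ofReal (32 * Real.pi ^ 2 * Real.sqrt Real.pi * Real.exp (-(3 : ℝ) / 2))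

/-- Dropping the decay clause gives back the parent crux, on the nose. [folklore] -/
theorem conicalGapWithoutDecay_iff : ConicalGapWithoutDecay ↔ NoncompactShrinkerGap := Iff.rfl

/-- The crux is a special case of the parent (as `conicalGap_of_noncompactShrinkerGap` of
Theorems/EntropyRungNoncompactShrinkerGapReduction.lean, restated to keep this file's imports slim): refuting
`ConicalGap` refutes `NoncompactShrinkerGap`, not conversely. [folklore] -/
theorem conicalGap_of_noncompactShrinkerGap' (h : NoncompactShrinkerGap) : ConicalGap := by
  intro M _ _ _ _ _ _ _ _ _ _ g _ f hg hc hf hsol hnorm hnf _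
  exact h M g f hg hc hf hsol hnorm hnf

/-- Sanity: the crux follows from each weakened statement by forgetting the dropped clause — e.g. from
`ConicalGapWithoutComplete` (so refuting the latter, §(e), does not touch the crux). [folklore] -/
theorem conicalGap_of_withoutComplete (h : ConicalGapWithoutComplete) : ConicalGap := by
  intro M _ _ _ _ _ _ _ _ _ _ g _ f hg _ hf hsol hnorm hnf hdec
  exact h M g f hg hf hsol hnorm hnf hdec

/-! ## (b) Checked negative lemmas (LANDED: Theorems/ConicalGap/Negative/LoadBearingHypotheses.lean, p124122) -/

/-- **Non-flatness is load-bearing** (Gaussian shrinker; the decay clause holds with `K = ∅`). Re-export of the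
landed `Negative.conicalGap_false_without_nonflat`. [folklore] -/
theorem conicalGap_false_without_nonflat' : ¬ ConicalGapWithoutNonflat :=
  ConicalGap.Negative.conicalGap_false_without_nonflat

/-- **Non-compactness is load-bearing** (`S⁴(√6)`, `f ≡ 2`, `∫ = 96π²e⁻² = 128.2 > 124.9`; decay vacuous with
`K = univ`). Re-export of the landed `Negative.conicalGap_false_without_noncompact`. [folklore] -/
theorem conicalGap_false_without_noncompact' : ¬ ConicalGapWithoutNoncompact :=
  ConicalGap.Negative.conicalGap_false_without_noncompact

/-! ## (c) Tightness is LOST on the conical class: the parent's extremiser and witnesses are excluded -/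

/-- On a non-compact space a function bounded below by a positive constant violates the decay clause
(also in Negative/DecayClause.lean, p126814, as `conicalGap_not_decayClause_of_pos_const_le`). [folklore] -/
theorem not_decay_of_pos_const_le (M : Type) [TopologicalSpace M] [NoncompactSpace M]
    (R : M → ℝ) (c : ℝ) (hc : 0 < c) (hR : ∀ x, c ≤ R x) :
    ¬ (∀ ε : ℝ, 0 < ε → ∃ K : Set M, IsCompact K ∧ ∀ x, x ∉ K → R x < ε) := by
  intro h
  obtain ⟨K, hK, hRK⟩ := h c hc
  have hKu : K = univ := by
    refine eq_univ_of_forall fun x ↦ ?_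
    by_contra hx
    exact absurd (hRK x hx) (not_lt.mpr (hR x))
  exact noncompact_univ M (hKu ▸ hK)

/-- The round cylinder (`R ≡ 3/2`) violates the decay clause. [folklore] -/
theorem roundCylinder_not_decay :
    ¬ (∀ ε : ℝ, 0 < ε → ∃ K : Set RoundCylinderFour.P4, IsCompact K ∧
        ∀ x, x ∉ K → RoundCylinderFour.cylP.scalarCurvature x < ε) :=
  not_decay_of_pos_const_le RoundCylinderFour.P4 _ (3 / 2) (by norm_num)
    fun x ↦ (RoundCylinderFour.scalarCurvature_cylP x).ge

/-- The parent's COMPLETENESS witness `S⁴(√6) ∖ pt` (`R ≡ 2`) violates the decay clause, so §(e) needs (and has) a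
conical witness instead. (The parent's NORMALISATION witness is the cylinder with `f − 1`: excluded likewise.)
[folklore] -/
theorem puncturedSphere_not_decay :
    ¬ (∀ ε : ℝ, 0 < ε → ∃ K : Set PuncturedSphereFour.W4, IsCompact K ∧
        ∀ x, x ∉ K → PuncturedSphereFour.punctP.scalarCurvature x < ε) :=
  not_decay_of_pos_const_le PuncturedSphereFour.W4 _ 2 (by norm_num)
    fun x ↦ (PuncturedSphereFour.scalarCurvature_punctP x).ge

/-- **The parent's extremiser is outside the class.** There is a model satisfying EVERY hypothesis of the parent
crux and attaining the constant `32π²√πe^{-3/2}` EXACTLY (the round cylinder `S³(2)×ℝ` on `ℝ⁴∖0`,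
`noncompactShrinkerGap_tight_at_cylinder`), and that model VIOLATES the decay clause (`R ≡ 3/2`). Consequence: on
the conical class the constant is not known to be sharp (best known member FIK, `Θ = .672`, `fikDensity_lt_thetaCyl`),
and the strict form `<` of `ConicalGap` is refuted by nothing in the tree or in print. [folklore] -/
theorem excludedExtremiser :
    ∃ (M : Type) (_ : TopologicalSpace M) (_ : T2Space M) (_ : SecondCountableTopology M)
      (_ : ChartedSpace (EuclideanSpace ℝ (Fin 4)) M) (_ : IsManifold (𝓡 4) ∞ M)
      (_ : ConnectedSpace M) (_ : NoncompactSpace M) (_ : T3Space M) (_ : MeasurableSpace M)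
      (_ : BorelSpace M)
      (g : PseudoRiemannianMetric (𝓡 4) ∞ (EuclideanSpace ℝ (Fin 4)) (TangentSpace (𝓡 4) : M → Type _))
      (_ : g.HasLeviCivita) (f : M → ℝ) (hg : g.IsRiemannian),
      (∀ (x : M) (r : NNReal), IsCompact {y : M | g.edist hg x y ≤ r}) ∧
      ContMDiff (𝓡 4) 𝓘(ℝ, ℝ) ∞ f ∧
      (∀ (x : M) (X Y : TangentSpace (𝓡 4) x),
        g.ricci x X Y + g.hessian f x X Y = (1 / 2 : ℝ) * g.val x X Y) ∧
      (∀ x : M, g.scalarCurvature x + g.gradSq f x = f x) ∧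
      (∃ x : M, g.scalarCurvature x ≠ 0) ∧
      ∫⁻ x, ENNReal.ofReal (Real.exp (-f x))
          ∂(riemannianMeasure (g.toContMDiffRiemannianMetric hg)) =
        ENNReal.ofReal (32 * Real.pi ^ 2 * Real.sqrt Real.pi * Real.exp (-(3 : ℝ) / 2)) ∧
      ¬ (∀ ε : ℝ, 0 < ε → ∃ K : Set M, IsCompact K ∧ ∀ x, x ∉ K → g.scalarCurvature x < ε) := by
  have hpt : RoundCylinderFour.P4 :=
    ⟨EuclideanSpace.single 0 1, NoncompactShrinkerGap.Negative.roundCylinderFour_point_mem⟩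
  exact ⟨RoundCylinderFour.P4, inferInstance, inferInstance, inferInstance, inferInstance,
    inferInstance, inferInstance, inferInstance, inferInstance, inferInstance, inferInstance,
    RoundCylinderFour.cylP, inferInstance, RoundCylinderFour.fP, RoundCylinderFour.isRiemannian_cylP,
    RoundCylinderFour.isCompact_setOf_edist_le, RoundCylinderFour.contMDiff_fP,
    RoundCylinderFour.soliton, RoundCylinderFour.normalisation,
    ⟨hpt, RoundCylinderFour.scalarCurvature_ne_zero hpt⟩, RoundCylinderFour.lintegral_exp_neg_fP,
    roundCylinder_not_decay⟩

/-- **Checked arithmetic for the best known member of the class**: FIK's density `Θ(FIK) = e^{√2−2}(1+√2)/2 = .672`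
(CHI 2004 §4; closed form from the Calabi ansatz: `μ = √2`, `Θ = e^{2(μ−1)}·e^{−μ}(1/μ + 1/μ²)`, re-derived in
`compute/calabi_family.py`) is BELOW `Θ(S³×ℝ) = 2√πe^{-3/2} = .791`: granted the closed form, FIK obeys the crux with
margin 15 %. The lemma is the arithmetic `e^{√2−2}(1+√2)/2 < 2√πe^{-3/2}`. [folklore] -/
theorem fikDensity_lt_thetaCyl :
    Real.exp (Real.sqrt 2 - 2) * (1 + Real.sqrt 2) / 2 < 2 * Real.sqrt Real.pi * Real.exp (-(3 : ℝ) / 2) := by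
  have h2 : Real.sqrt 2 < 1.4143 := (Real.sqrt_lt' (by norm_num)).mpr (by norm_num)
  have hπ : (1.7724 : ℝ) < Real.sqrt Real.pi :=
    (Real.lt_sqrt (by norm_num)).mpr (by nlinarith [Real.pi_gt_d6])
  have hexp : Real.exp (Real.sqrt 2 - 2) < Real.exp 1 * Real.exp (-(3 : ℝ) / 2) := by
    rw [← Real.exp_add]
    exact Real.exp_lt_exp.mpr (by linarith)
  have he1 : Real.exp 1 < 2.7182818286 := Real.exp_one_lt_d9
  have hE : 0 < Real.exp (-(3 : ℝ) / 2) := Real.exp_pos _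
  have hs : 0 < 1 + Real.sqrt 2 := by positivity
  calc Real.exp (Real.sqrt 2 - 2) * (1 + Real.sqrt 2) / 2
      < Real.exp 1 * Real.exp (-(3 : ℝ) / 2) * (1 + Real.sqrt 2) / 2 := by gcongr
    _ ≤ 2.7182818286 * Real.exp (-(3 : ℝ) / 2) * 2.4143 / 2 := by gcongr; linarith
    _ < 2 * 1.7724 * Real.exp (-(3 : ℝ) / 2) := by nlinarith
    _ ≤ 2 * Real.sqrt Real.pi * Real.exp (-(3 : ℝ) / 2) := by gcongr

/-! ## (c') Statement hygiene (all PROVED): two-sided decay, `R ≥ 0`, hidden finiteness, redundant binder -/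

/-- `ConicalGap` with the decay clause made TWO-SIDED (`|R| < ε` off a compact set, i.e. `R → 0`). -/
def ConicalGapTwoSided : Prop :=
  ∀ (M : Type) [TopologicalSpace M] [T2Space M] [SecondCountableTopology M]
    [ChartedSpace (EuclideanSpace ℝ (Fin 4)) M] [IsManifold (𝓡 4) ∞ M] [ConnectedSpace M]
    [NoncompactSpace M] [T3Space M] [MeasurableSpace M] [BorelSpace M]
    (g : PseudoRiemannianMetric (𝓡 4) ∞ (EuclideanSpace ℝ (Fin 4)) (TangentSpace (𝓡 4) : M → Type _))
    [g.HasLeviCivita] (f : M → ℝ) (hg : g.IsRiemannian),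
    (∀ (x : M) (r : NNReal), IsCompact {y : M | g.edist hg x y ≤ r}) →
    ContMDiff (𝓡 4) 𝓘(ℝ, ℝ) ∞ f →
    (∀ (x : M) (X Y : TangentSpace (𝓡 4) x),
      g.ricci x X Y + g.hessian f x X Y = (1 / 2 : ℝ) * g.val x X Y) →
    (∀ x : M, g.scalarCurvature x + g.gradSq f x = f x) →
    (∃ x : M, g.scalarCurvature x ≠ 0) →
    (∀ ε : ℝ, 0 < ε → ∃ K : Set M, IsCompact K ∧ ∀ x, x ∉ K → |g.scalarCurvature x| < ε) →
    ∫⁻ x, ENNReal.ofReal (Real.exp (-f x))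
        ∂(riemannianMeasure (g.toContMDiffRiemannianMetric hg)) ≤
      ENNReal.ofReal (32 * Real.pi ^ 2 * Real.sqrt Real.pi * Real.exp (-(3 : ℝ) / 2))

/-- `ConicalGap` with the extra hypothesis `R ≥ 0` everywhere. -/
def ConicalGapNonnegScalar : Prop :=
  ∀ (M : Type) [TopologicalSpace M] [T2Space M] [SecondCountableTopology M]
    [ChartedSpace (EuclideanSpace ℝ (Fin 4)) M] [IsManifold (𝓡 4) ∞ M] [ConnectedSpace M]
    [NoncompactSpace M] [T3Space M] [MeasurableSpace M] [BorelSpace M]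
    (g : PseudoRiemannianMetric (𝓡 4) ∞ (EuclideanSpace ℝ (Fin 4)) (TangentSpace (𝓡 4) : M → Type _))
    [g.HasLeviCivita] (f : M → ℝ) (hg : g.IsRiemannian),
    (∀ (x : M) (r : NNReal), IsCompact {y : M | g.edist hg x y ≤ r}) →
    ContMDiff (𝓡 4) 𝓘(ℝ, ℝ) ∞ f →
    (∀ (x : M) (X Y : TangentSpace (𝓡 4) x),
      g.ricci x X Y + g.hessian f x X Y = (1 / 2 : ℝ) * g.val x X Y) →
    (∀ x : M, g.scalarCurvature x + g.gradSq f x = f x) →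
    (∃ x : M, g.scalarCurvature x ≠ 0) →
    (∀ x : M, 0 ≤ g.scalarCurvature x) →
    (∀ ε : ℝ, 0 < ε → ∃ K : Set M, IsCompact K ∧ ∀ x, x ∉ K → g.scalarCurvature x < ε) →
    ∫⁻ x, ENNReal.ofReal (Real.exp (-f x))
        ∂(riemannianMeasure (g.toContMDiffRiemannianMetric hg)) ≤
      ENNReal.ofReal (32 * Real.pi ^ 2 * Real.sqrt Real.pi * Real.exp (-(3 : ℝ) / 2))

/-- **The one-sidedness of the decay clause is immaterial for the crux (UNCONDITIONAL)**: by Zhang 2009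
Thm 1.3 (ii), PROVED in the tree (`shrinkerScalarCurvature_nonneg_holds`), every datum of the crux has `R ≥ 0`, so
`ConicalGap` is equivalent to its two-sided form "`R → 0` at infinity". (WITHOUT completeness this fails: §(e).)
[cite: Zhang2009, Thm. 1.3 (ii)] -/
theorem conicalGap_iff_twoSided : ConicalGap ↔ ConicalGapTwoSided := by
  constructor
  · intro h M _ _ _ _ _ _ _ _ _ _ g _ f hg hc hf hsol hnorm hnf hdec
    refine h M g f hg hc hf hsol hnorm hnf fun ε hε ↦ ?_
    obtain ⟨K, hK, hRK⟩ := hdec ε hε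
    exact ⟨K, hK, fun x hx ↦ (le_abs_self _).trans_lt (hRK x hx)⟩
  · intro h M _ _ _ _ _ _ _ _ _ _ g _ f hg hc hf hsol hnorm hnf hdec
    have hR0 : ∀ x, 0 ≤ g.scalarCurvature x :=
      shrinkerScalarCurvature_nonneg_holds 4 M g f hg hc hf hsol hnorm
    refine h M g f hg hc hf hsol hnorm hnf fun ε hε ↦ ?_
    obtain ⟨K, hK, hRK⟩ := hdec ε hε
    exact ⟨K, hK, fun x hx ↦ by rw [abs_of_nonneg (hR0 x)]; exact hRK x hx⟩

/-- **`R ≥ 0` may be assumed for free (UNCONDITIONAL)**, by the same proved fact. [cite: Zhang2009, Thm. 1.3 (ii)] -/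
theorem conicalGap_iff_nonnegScalar : ConicalGap ↔ ConicalGapNonnegScalar := by
  constructor
  · intro h M _ _ _ _ _ _ _ _ _ _ g _ f hg hc hf hsol hnorm hnf _ hdec
    exact h M g f hg hc hf hsol hnorm hnf hdec
  · intro h M _ _ _ _ _ _ _ _ _ _ g _ f hg hc hf hsol hnorm hnf hdec
    exact h M g f hg hc hf hsol hnorm hnf
      (shrinkerScalarCurvature_nonneg_holds 4 M g f hg hc hf hsol hnorm) hdec

/-- **Hidden content**: the crux forces `∫ e^{-f} dV < ∞` on the class (a form of Cao–Zhou 2010; easy here since an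
asymptotically conical shrinker has `f = r²/4 + O(1)` and Euclidean volume growth). [folklore] -/
theorem lintegral_lt_top_of_conicalGap (h : ConicalGap)
    (M : Type) [TopologicalSpace M] [T2Space M] [SecondCountableTopology M]
    [ChartedSpace (EuclideanSpace ℝ (Fin 4)) M] [IsManifold (𝓡 4) ∞ M] [ConnectedSpace M]
    [NoncompactSpace M] [T3Space M] [MeasurableSpace M] [BorelSpace M]
    (g : PseudoRiemannianMetric (𝓡 4) ∞ (EuclideanSpace ℝ (Fin 4)) (TangentSpace (𝓡 4) : M → Type _))
    [g.HasLeviCivita] (f : M → ℝ) (hg : g.IsRiemannian)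
    (hc : ∀ (x : M) (r : NNReal), IsCompact {y : M | g.edist hg x y ≤ r})
    (hf : ContMDiff (𝓡 4) 𝓘(ℝ, ℝ) ∞ f)
    (hsol : ∀ (x : M) (X Y : TangentSpace (𝓡 4) x),
      g.ricci x X Y + g.hessian f x X Y = (1 / 2 : ℝ) * g.val x X Y)
    (hnorm : ∀ x : M, g.scalarCurvature x + g.gradSq f x = f x)
    (hnf : ∃ x : M, g.scalarCurvature x ≠ 0)
    (hdec : ∀ ε : ℝ, 0 < ε → ∃ K : Set M, IsCompact K ∧ ∀ x, x ∉ K → g.scalarCurvature x < ε) :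
    ∫⁻ x, ENNReal.ofReal (Real.exp (-f x))
        ∂(riemannianMeasure (g.toContMDiffRiemannianMetric hg)) < (⊤ : ℝ≥0∞) :=
  (h M g f hg hc hf hsol hnorm hnf hdec).trans_lt ENNReal.ofReal_lt_top

/-- **Statement hygiene**: the binder `[T3Space M]` is redundant (Hausdorff + charted on `ℝ⁴` ⇒ locally compact
⇒ regular). [folklore] -/
theorem t3Space_of_chartedSpace (M : Type) [TopologicalSpace M] [T2Space M]
    [ChartedSpace (EuclideanSpace ℝ (Fin 4)) M] : T3Space M := by
  haveI : LocallyCompactSpace M := ChartedSpace.locallyCompactSpace (EuclideanSpace ℝ (Fin 4)) M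
  infer_instance

/-! ## (d) Targets and line `Sketch` (card `avr-window`; lead gen 1, skeleton v1, `Cruxes/ConicalGap/Lines/Sketch.lean`)

No stuck stubs were handed over (payload.targets = []). Attack on the five registered stubs of the picked line:

* `stub_weightedIntegrability` (all `τ > 0`): TRUE on complete shrinkers by quadratic growth of `f` and Euclidean
  volume growth (Cao–Zhou 2010; tree: `shrinkerPotentialGrowth`), `R e^{-f/τ} ≤ f e^{-f/τ}`; compact `M` trivial.
  Not refutable; its only load-bearing hypothesis is completeness (the explicit incomplete family of §(e) still has
  all three weights integrable — `∫ φ e^{-μφ/τ} dφ < ∞` — so even that is not witnessed as necessary HERE).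
* `stub_weightedIdentity` `∫(f − 2τ)e^{-f/τ} = (1−τ)∫Re^{-f/τ}`: `= ∫Δ_g(e^{-f/τ}) dV = 0` (`Δf = 2 − R`,
  `|∇f|² = f − R`). Verified by hand on the three tree models: Gaussian (`∫fe^{-f/τ} = 32π²τ³ = 2τ·16π²τ²`, `R = 0`),
  `S⁴(√6)` (`(2−2τ)e^{-2/τ}·Vol` on both sides), `S³(2)×ℝ` (`(3/2)(1−τ)e^{-3/(2τ)}√(4πτ)·Vol(S³(2))` on both sides),
  and on FIK numerically by ideator 1 (`fik_checks.py`). On the INCOMPLETE family of §(e) it FAILS (boundary flux at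
  the inner end: `∫Δ(e^{-f/τ}) ≠ 0`), consistently with completeness being load-bearing. Survives.
* `stub_transformFinite`, `stub_transformLimit`: pure measure theory (Fubini on `X × [1,T]` with the dominations
  `|∂_τ(τ⁻²e^{-t/τ})| ≤ τ⁻⁴(t+2τ)e^{-t/T}` for `τ ≤ T`; monotone convergence in `T` using `R ≥ 0`). TRUE as stated
  for every σ-finite `μ`; degenerate data (`μ = 0`; `f ≡ 0` forces `μ = 0` through the identity at `τ = 1`) consistent.
* `stub_coreBudget` (apex) = the crux in transformed coordinates (`∫e^{-f} = 16π²a + ∫Rk(f)`): inherits §(a)–(e)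
  verbatim. On the explicit incomplete family `a = lim (16π²T²)⁻¹∫e^{-f/T}dV = 1/μ² > 1` (FAT cone, `AVR > 1`) and
  `∫⁻ ofReal(R·k(f)) = 0` because `ofReal` CLIPS the negative `R`: the apex minus completeness is false by the same
  witnesses, and the apex is equivalent to the crux only through `R ≥ 0` (Zhang; PROVED in the tree, used in
  `ConicalGap_of`). Joint sufficiency holds (`ConicalGap_of` sorry-free over the stubs): no smuggled gap.
  VERDICT for the lead: no stub refuted; nothing mis-stated; the transform is an identity, so the line moves the
  difficulty, it does not split it — `stub_coreBudget` is exactly as open as the crux (disprover has no cheaper target).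
-/

/-! ## (e) Near-misses: load-bearing hypotheses with PAPER witnesses not yet constructible in the tree
(`sorry` permitted in this work file only; each docstring carries the witness and the obstruction) -/

/-- **Completeness is load-bearing — EXPLICIT CLOSED-FORM WITNESSES (new, cycle 1).** For `0 < μ < 1` let
`(M_μ, g_μ)` be the U(2)-invariant Kähler metric on `M_μ = {z ∈ ℂ² : |z| > r₀(μ)} ⊂ ℝ⁴` (ONE chart) given by the
Calabi ansatz `ω₁ = i∂∂̄P(log|z|²)`, `g = 2g₁`, with momentum profile (λ = 1 units)
`ψ(φ) = P'' = φ/μ + 2(1−μ)/μ² + 2(1−μ)/(μ³φ)` on `φ = P' ∈ (0, ∞)` — the `D = 0` (conical) solutions of the linear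
shrinker ODE `ψ_φ = (μ − 1/φ)ψ + 2 − φ`, of which `μ = 1` is the Gaussian and `μ = √2` (on `φ > 1`) is FIK — and
`f = μφ + 2(1−μ)`. THEN: `Ric + Hess f = g/2`; `R = 2(μ−1)/(μφ) < 0` everywhere (so `∃ x, R x ≠ 0`, and the decay
clause holds with `K = ∅`); `R + |∇f|² = f` (`|∇f|²_g = μ²ψ`); `M_μ ≅ ℝ⁴ ∖ B̄` connected non-compact; `f` smooth;
the inner end `|z| → r₀` (`φ → 0`: base `ℂP¹` collapses, Hopf fibre and `|R|` blow up) is at FINITE distance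
`∫₀ dφ/√(2ψ) < ∞` — incomplete — while the outer end is a complete cone with `AVR = 1/μ² > 1`; and
`∫ e^{-f} dV = 16π² ∫₀^∞ e^{-μφ − 2(1−μ)} φ dφ = 16π²·e^{2(μ−1)}/μ² > 16π² ≈ 157.9 > 124.9` for EVERY `μ ∈ (0,1)`
(`Θ(1/2) = 4/e = 1.47`; `Θ → ∞` as `μ → 0`). Every identity is re-derived twice (transverse/radial components;
`R₁ = −2ψ'' − 4(ψ'−1)/φ`) and checked numerically with FIK calibration `Θ = .67196` in `compute/calabi_family.py`
(evidence on the item, with `CompletenessWitness.md`). Numerically also (compute/conical_ends.py): SO(4)-invariant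
conical shrinker ENDS `ds² + a(s)²g_{S³}` over `C(S³(α))`, cut at the first zero of `R`, give incomplete annuli with
`R > 0`, `R → 0` at both ends and mass `156.0 (α = .99) … 127.4 (α = .8) > 124.9`: completeness stays necessary even
with two-sided decay and `R > 0`. OBSTRUCTION to a Lean proof (engineering): the tree's model dictionary builds
conformally flat metrics on open subsets of `ℝ⁴` (and the round `S⁴`); this witness is a NON-conformally-flat
Hermitian metric whose radial profile `φ(|z|²)` is the inverse of the elementary but transcendental
`t(φ) = ∫ dφ/ψ(φ)`, and its curvature needs the chart formula for `Ric` of a general metric — none of it in the tree.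
[cite: FeldmanIlmanenKnopf2003, §§2–4 (Calabi ansatz, the U(n)-invariant shrinker ODE)] -/
theorem conicalGap_false_without_complete : ¬ ConicalGapWithoutComplete := by
  sorry

/-- **Connectedness is load-bearing** — witness (new for this crux, both components IN THE TREE): the disjoint union
`S⁴(√6) ⊔ ℝ⁴_Gauss` with `f = 2 ⊔ |x|²/4`: non-compact (Gaussian component), complete, normalised shrinker on each
component, `R = 2 ≠ 0` on the sphere, decay clause with `K = S⁴(√6)` (compact; `R = 0` off it), and
`∫ e^{-f} dV = 96π²e⁻² + 16π² = 286.1 > 124.9` (either summand alone exceeds the bound). No FIK needed (the parent's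
two-cylinder witness is excluded here by decay). OBSTRUCTION (engineering, as in the parent §(e)): no
`PseudoRiemannianMetric` / `HasLeviCivita` / `riemannianMeasure` API over a `Sum` charted space (Mathlib has the
`ChartedSpace`/`IsManifold` instances on `M ⊕ M'`; the tree's section dictionary is single-component), and the
components cannot be realised as one open subset of `ℝ⁴` (`S⁴` is closed). Not load-bearing for provers (proofs
localise to a component). [folklore] -/
theorem conicalGap_false_without_connected : ¬ ConicalGapWithoutConnected := by
  sorry

/-- **The normalisation is load-bearing** — witness: FIK on `O(−1) → ℂP¹` (the `μ = √2`, `φ > 1` member of the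
family above, complete, `R = (2−√2)·(1/φ) → 0`, `Θ = e^{√2−2}(1+√2)/2 = .672`) with the shifted potential `f − c`,
`c > log(.791/.672) = .163`: `Ric + Hess(f − c) = g/2` and every other hypothesis hold, `∫e^{-(f−c)} = e^{c}·106.1 >
124.9`. OBSTRUCTION: FIK is not in the tree (two charts: the bolt `ℂP¹`; same non-conformally-flat U(2) ansatz as
above). [cite: FeldmanIlmanenKnopf2003, Thm 1.2 / §4] -/
theorem conicalGap_false_without_normalisation : ¬ ConicalGapWithoutNormalisation := by
  sorry

/-! ## (f) Numerical record (pure python, this folder `compute/`; evidence on the item)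

`calabi_family.py` — the explicit family of §(e): ODE residual of `ψ_μ` < 6e-7 (finite differences), `R` by the
trace identity = closed form to 2e-7, `R + |∇f|² − f ≡ 0` to 3e-15, FIK calibration `ψ(1) = 0`, `ψ'(1) = 1`,
`R(1) = 2 − √2`, `Θ(FIK) = .671958` (CHI .672); table `μ : Θ(μ) = e^{2(μ−1)}/μ²`, mass, inner `t`-range and inner
distance (both finite): `.99: 1.0001, 157.93`; `.9: 1.0108, 159.6`; `.8: 1.047, 165.4`; `.5: 1.4715, 232.4`;
`.3: 2.74, 432.7`; `.1: 16.5, 2610` — all `> 124.9`, `R < 0`.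
`conical_ends.py` — SO(4)-invariant shrinker ends `ds² + a²g_{S³}`: `a'' = 2(1−a'²)/a + f'a' − a/2`,
`f'' = 1/2 + 3a''/a`, inward RK4 (h = 1e-3) from `s = 14` with the conical expansion `a = αs + 2(1−α²)/(αs) + O(s⁻³)`,
`f' = s/2 + O(s⁻³)`; calibration `α = 1` ⇒ Gaussian, mass `157.914 = 16π²`; for `α < 1` the end continues smoothly
to small `s` with `R > 0` near infinity, ONE zero `s*` of `R`, and mass beyond `s*`:
`α = .99: s* = .43, m = 156.0`; `.95: .55, 148.8`; `.9: .55, 140.6`; `.8: .44, 127.4` (> 124.9); `.7: .21, 118.9`;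
for `α > 1` (fat cones) `R < 0` near infinity and the end blows up (`a → 0`, `|R| → ∞`) at finite `s` with no zero
of `R`. Neither family closes up smoothly (Kotschwar 2008 / FIK uniqueness), as it must be.
Literature this cycle (search degraded: local FTS reset, OpenAlex/S2 HTTP 429; zbMATH + arXiv reads): Munteanu–Sesum,
J. Geom. Anal. 23 (2013) = arXiv:0910.1105, Prop 3.3 (ends with `R ≤ α < n/2 − 1` are non-parabolic), Thm 1.4 (Kähler:
at most one non-parabolic end); Munteanu–Wang, CAG 20 (2012) = arXiv:1112.3027 (no bound on the number of ends of a
shrinker; volume growth at least linear). No new complete AC 4-d shrinker (grounder/rattack logs of 2026-08-16 stand).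
-/

end Summit.SmoothPoincare4.SmoothPoincare4.Cruxes.ConicalGap.Disproof

end
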